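import Literature.MathematicalPhysics.QuantumFieldTheory.Balaban1983to89.B5Eq118OneStroke
import Literature.MathematicalPhysics.QuantumFieldTheory.BalabanImbrieJaffe1984to88.BIJ85Eq5113Proof

/-!
# `Balaban1983to89.B5AveragingLocalityV1` — T. Bałaban, *Propagators and renormalization transformations for lattice gauge
# theories. I*, Commun. Math. Phys. **95** (1984) 17–40 [Balaban1984PropagatorsI], Sect. A (1.8), (1.11), (1.13), (1.18), (1.20):
# LINEARITY and BLOCK LOCALITY of the averaging operations `Q`, `Q′`, `Q_k`, `Q′_k` of the V1 lattice calculus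
# `LatticeFieldCalculus` — *"x(c) denotes a point in the block B(c₊) obtained by translation of x by the bond c"* (p. 19): the
# straight contour `[x, x(c)]` of (1.11) stays inside `B(c₋) ∪ B(c₊)`, so `(QA)(c)` only sees the bonds with both end-points there

statement-level skeleton of published theorems with citation tags; proofs where landed; nothing here is a claim about the
Yang–Mills mass gap

PDF held: `paper:balaban1984-cmp95-propagators-rt-i` (journal page = PDF page + 16); pp. 18–20 read on the ×2 renders
`run/shared/lean/pub/pub-balaban/b2b-balaban-ref1/pages/1984-cmp95-propagators-rt-I/…-p002…p004-x2.png`.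

CITATION HEADER (lean-in-tree rule).  Cell `lit-balaban` (HOME `run/shared/lean/pub/lit-balaban/`), PHASE-2 proof seat **p21**
(gen 5); support file (bookkeeping on the carriers OF RECORD `Site P j` / `VecField P j V` / `SiteField P j V` of `Setup` and the
averages `bondAvg` (1.11), `siteAvg` (1.13), `bondAvgIter` (1.16)–(1.18), `siteAvgIter` (1.20) of `LatticeFieldCalculus`, r18
p239006) for the B6 Sect. A model instance `…B6SectADomainsV1` / `…B6SectAZeroModesV1` / `…B6SectAVectorModelV1` (r03's Phase-2
target P2).  Rows touched: B5.Eq1.11-1.18 (API: linearity, locality; the decls of record are r18's, the one-stroke formula (1.18) is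
p39's `…B5Eq118OneStroke`, surjectivity is p11's `…B5AveragingOnto` — nothing of theirs is restated).

PRINT (p. 19, verbatim).  *"(QA)_c = Σ_{x∈B(c₋)} L^{−(d+1)} A([x, x(c)]), (1.11) where x(c) denotes a point in the block B(c₊)
obtained by translation of x by the bond c, so if c = ⟨y, y + Le_μ⟩ then x(c) = x + Le_μ"*; *"(Q′λ)(y) = Σ_{x∈B(y)} L^{−d} λ(x).
(1.13)"*; p. 20 *"(Q_kA)_b = Σ_{x∈B^k(b₋)} η^{d+1} A([x, x(b)]) (1.18)"*, *"(Q′_kλ)(y) = Σ_{x∈B^k(y)} η^d λ(x) (1.20)"*.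

WHAT IS PROVED (0 sorry, 0 new named facts; axioms standard).  §1: linearity of `Q`, `Q′`, `Q_k`, `Q′_k`, `∂` is ALREADY in
the tree (`…BIJ85AxialPropagator411`, `…BIJ85GaugeFunction5113`, `…BIJ85Eq5113Proof` — imported and re-used, not restated).  §2 (standing range `j + 1 ≤ m + K`): `blockOf_runSite_blockSite` — the site `x + te_μ` of the straight contour from
`x = blockSite y r ∈ B(y)`, `t ≤ L`, lies in `B(y)` while `r_μ + t < L` and in `B(y + e_μ)` afterwards; hence every bond of the
contour `[x, x(c)]` has both end-points in `B(c₋) ∪ B(c₊)` (`runBond_blockSite_local`) and `(QA)(c) = 0` whenever `A` vanishes on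
such bonds (`bondAvg_eq_zero_of_local`); `(Q′λ)(y) = 0` whenever `λ` vanishes on `B(y)` (`siteAvg_eq_zero_of_local`).
-/

namespace Literature.MathematicalPhysics.QuantumFieldTheory.Balaban1983to89.B5AveragingLocalityV1

open LatticeFieldCalculus B5Eq118OneStroke B5Eq120IterProof
open BalabanImbrieJaffe1984to88.BIJ85AxialPropagator411 (bondAvg_add bondAvg_smul bondAvg_zero bondAvgIter_add bondAvgIter_smul
  bondAvgIter_map_zero)
open BalabanImbrieJaffe1984to88.BIJ85GaugeFunction5113 (siteAvg_add siteAvg_sub siteAvg_smul siteAvgIter_add siteAvgIter_sub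
  siteAvgIter_smul grad_add grad_sub grad_smul grad_zero)
open BalabanImbrieJaffe1984to88.BIJ85Eq5113Proof (bondAvgIter_sub)

noncomputable section

variable {P : Params} {j : ℕ}

/-! ## §1. Linearity of the averages (1.11)/(1.13)/(1.16)–(1.20): the tree's lemmas, re-exported by `open`

`bondAvg_add/_smul/_zero`, `bondAvgIter_add/_smul/_map_zero` are `…BIJ85AxialPropagator411` (p09), `siteAvg_add/_sub/_smul`,
`siteAvgIter_add/_sub/_smul`, `grad_add/_sub/_smul/_zero` are `…BIJ85GaugeFunction5113` (p08), `bondAvgIter_sub` is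
`…BIJ85Eq5113Proof` (p08); only the three one-liners below are new. -/

section Linear

variable {V : Type*} [AddCommGroup V] [Module ℝ V]

/-- `Q′ 0 = 0`. [cite: Balaban1984PropagatorsI, (1.13) p.19] -/
theorem siteAvg_zero : siteAvg (0 : SiteField P j V) = 0 := by
  funext y; simp [siteAvg]

/-- `Q′_k 0 = 0`. [cite: Balaban1984PropagatorsI, (1.20) p.20] -/
theorem siteAvgIter_map_zero (k : ℕ) : siteAvgIter k (0 : SiteField P 0 V) = 0 := by
  have h := siteAvgIter_smul (P := P) k (0 : ℝ) (0 : SiteField P 0 V)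
  simpa using h

/-- `gaugeShift c λ A = A − ∂λ` ((1.4) as a difference of bond fields). [cite: Balaban1984PropagatorsI, (1.4) p.18] -/
theorem gaugeShift_eq_sub (c : ℝ) (lam : SiteField P j V) (A : VecField P j V) : gaugeShift c lam A = A - grad c lam := by
  funext b; rfl

end Linear

/-! ## §2. Block locality of the one-level averages on the torus `T^{(j)}` ((1.11), (1.13); standing range `j + 1 ≤ m + K`) -/

section Locality

variable {V : Type*} [AddCommGroup V] [Module ℝ V]

/-- the `μ`-coordinate of the site `blockSite y r + t e_μ` is the label `(y_μ L + r_μ) + t`. [folklore] -/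
private theorem runSite_blockSite_apply_self (y : Site P (j + 1)) (r : Fin P.d → Fin P.L) (μ : Fin P.d) (t : ℕ) :
    (runSite (Site.blockSite y r) μ t) μ = (((y μ).val * P.L + r μ + t : ℕ) : ZMod (P.sitesPerDir j)) := by
  simp only [runSite, Function.update_self, Site.blockSite]
  push_cast
  ring

/-- the other coordinates of `blockSite y r + t e_μ` are those of `blockSite y r`. [folklore] -/
private theorem runSite_apply_of_ne (x : Site P j) {μ ν : Fin P.d} (h : ν ≠ μ) (t : ℕ) : (runSite x μ t) ν = x ν := by
  simp only [runSite, Function.update_of_ne h]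

/-- THE STRAIGHT CONTOUR STAYS IN `B(c₋) ∪ B(c₊)` (p. 19: *"x(c) denotes a point in the block B(c₊) obtained by translation of x by
the bond c"*): the site `x + t e_μ`, `x = blockSite y r ∈ B(y)`, `t ≤ L`, lies in `B(y)` while `r_μ + t < L` and in `B(y + e_μ)`
afterwards. [cite: Balaban1984PropagatorsI, (1.8) p.19] -/
theorem blockOf_runSite_blockSite (hj : j + 1 ≤ P.m + P.K) (y : Site P (j + 1)) (r : Fin P.d → Fin P.L) (μ : Fin P.d)
    {t : ℕ} (ht : t ≤ P.L) :
    blockOf (runSite (Site.blockSite y r) μ t) = if (r μ : ℕ) + t < P.L then y else y.shift μ := by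
  have hL := P.L_pos
  funext ν
  by_cases hν : ν = μ
  · subst hν
    have hval : ((blockOf (runSite (Site.blockSite y r) ν t)) ν)
        = (((((y ν).val * P.L + r ν + t) % P.sitesPerDir j) / P.L : ℕ) : ZMod (P.sitesPerDir (j + 1))) := by
      simp only [blockOf, runSite_blockSite_apply_self, ZMod.val_natCast]
    rw [hval, P.sitesPerDir_eq_mul_succ hj, Nat.mod_mul_left_div_self, ZMod.natCast_mod,
      show (y ν).val * P.L + r ν + t = P.L * (y ν).val + ((r ν : ℕ) + t) by ring,
      Nat.mul_add_div hL, Nat.cast_add, ZMod.natCast_zmod_val]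
    by_cases h : (r ν : ℕ) + t < P.L
    · rw [if_pos h, Nat.div_eq_of_lt h, Nat.cast_zero, add_zero]
    · rw [if_neg h]
      have hr := (r ν).isLt
      have h1 : ((r ν : ℕ) + t) / P.L = 1 := Nat.div_eq_of_lt_le (by omega) (by omega)
      rw [h1, Nat.cast_one]
      simp [Site.shift]
  · have h1 : (blockOf (runSite (Site.blockSite y r) μ t)) ν = (blockOf (Site.blockSite y r)) ν := by
      simp only [blockOf, runSite_apply_of_ne _ hν]
    rw [h1, Site.blockOf_blockSite hj]
    by_cases h : (r μ : ℕ) + t < P.L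
    · rw [if_pos h]
    · rw [if_neg h]; simp [Site.shift, Function.update_of_ne hν]

/-- … hence it lies in `B(y)` or in `B(y + e_μ)`. [cite: Balaban1984PropagatorsI, (1.8) p.19] -/
theorem blockOf_runSite_blockSite_or (hj : j + 1 ≤ P.m + P.K) (y : Site P (j + 1)) (r : Fin P.d → Fin P.L) (μ : Fin P.d)
    {t : ℕ} (ht : t ≤ P.L) :
    blockOf (runSite (Site.blockSite y r) μ t) = y ∨ blockOf (runSite (Site.blockSite y r) μ t) = y.shift μ := by
  rw [blockOf_runSite_blockSite hj y r μ ht]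
  split_ifs
  · exact Or.inl rfl
  · exact Or.inr rfl

/-- the end-points of the `t`-th bond of the contour `[x, x(c)]`, `x ∈ B(c₋)`, lie in `B(c₋) ∪ B(c₊)`. [cite: Balaban1984PropagatorsI, (1.11) p.19] -/
theorem runBond_blockSite_local (hj : j + 1 ≤ P.m + P.K) (c : PBond P (j + 1)) (r : Fin P.d → Fin P.L) {t : ℕ}
    (ht : t < P.L) :
    (blockOf (runBond (Site.blockSite c.src r) c.dir t).src = c.src ∨
        blockOf (runBond (Site.blockSite c.src r) c.dir t).src = c.tgt) ∧
      (blockOf (runBond (Site.blockSite c.src r) c.dir t).tgt = c.src ∨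
        blockOf (runBond (Site.blockSite c.src r) c.dir t).tgt = c.tgt) := by
  refine ⟨?_, ?_⟩
  · exact blockOf_runSite_blockSite_or hj c.src r c.dir ht.le
  · have htgt : (runBond (Site.blockSite c.src r) c.dir t).tgt = runSite (Site.blockSite c.src r) c.dir (t + 1) := by
      simp only [runBond, PBond.tgt, runSite_succ]
    rw [htgt]
    exact blockOf_runSite_blockSite_or hj c.src r c.dir ht

/-- BLOCK LOCALITY OF `Q` (1.11): if the bond field vanishes on every fine bond with both end-points in `B(c₋) ∪ B(c₊)`, then
`(QA)(c) = 0`. [cite: Balaban1984PropagatorsI, (1.11) p.19] -/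
theorem bondAvg_eq_zero_of_local (hj : j + 1 ≤ P.m + P.K) (X : VecField P j V) (c : PBond P (j + 1))
    (h : ∀ b : PBond P j, (blockOf b.src = c.src ∨ blockOf b.src = c.tgt) →
      (blockOf b.tgt = c.src ∨ blockOf b.tgt = c.tgt) → X b = 0) :
    bondAvg X c = 0 := by
  unfold bondAvg
  rw [Finset.sum_eq_zero, smul_zero]
  intro r _
  unfold segSum
  refine Finset.sum_eq_zero fun t ht => ?_
  have hl := runBond_blockSite_local hj c r (Finset.mem_range.mp ht)
  exact h _ hl.1 hl.2

/-- BLOCK LOCALITY OF `Q′` (1.13): if `λ` vanishes on `B(y)`, then `(Q′λ)(y) = 0`. [cite: Balaban1984PropagatorsI, (1.13) p.19] -/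
theorem siteAvg_eq_zero_of_local (hj : j + 1 ≤ P.m + P.K) (f : SiteField P j V) (y : Site P (j + 1))
    (h : ∀ z : Site P j, blockOf z = y → f z = 0) : siteAvg f y = 0 := by
  unfold siteAvg
  rw [Finset.sum_eq_zero, smul_zero]
  intro r _
  exact h _ (Site.blockOf_blockSite hj y r)

end Locality

end

end Literature.MathematicalPhysics.QuantumFieldTheory.Balaban1983to89.B5AveragingLocalityV1
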